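import Summits.HodgeConjecture.HodgeConjecture.Theorems.Ring2AbelianAllAndreLerayIdempotentFromLifts
import Summits.HodgeConjecture.HodgeConjecture.Theorems.Ring2AbelianAllAndreLiebermanDischargedRows
import Summits.HodgeConjecture.HodgeConjecture.Theorems.BoundaryReadoutPullbackAlgebraic
import HarnessLib

/-!
# Ring 2 · sub-cell AbelianAll (ALL ABELIAN VARIETIES), André axis, part XXVIII-c — THE COMPLEMENTARY CLAUSE IS SUPERFLUOUS:
# on a compact pencil of abelian `d`-folds, for EVERY `p ≤ d`, "every invariant class of degree `2p` of `X_t` is the restriction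
# of an algebraic class of `𝒳`" ⟺ "there is an algebraic Leray idempotent at `(t, 2p)` with algebraic image" ⟺
# "`Nᵖ(𝒳) + ker j_t^* = H^{2p}(𝒳)`" — with NO hypothesis on the complementary degree (hard Lefschetz below the middle,
# Lieberman's `A(X_t)` above it, Fulton's pull-back theorem; all tree theorems)

HONEST FRAMING (page 1, verbatim): **research route, not a corollary; conditional on HC_CM plus one named
minimal statement.** Cell line: research route conditional on HC_CM; not a corollary; Q11.4-sentence-2
already refuted in dim ≥ 3. Nothing in this file proves a case of the Hodge conjecture for an abelian variety; `HC_CM` does not occur in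
this file; item `Theses.RankFourFaces.CMToAbelian` (stmt-16267) OPEN and not closed here. Seat `pub-hodge-ring2-ab-andre-2`, gen 20; brief
(ii)/(iii).

## What part XXVIII-a left and what this file removes

Part XXVIII-a (`exists_lerayIdempotent_of_range_le_map`) builds the idempotent at `(t, 2p)` from (A) "`j_t^* H^{2p}(𝒳) ⊆ j_t^* Nᵖ(𝒳)`"
AND (B) "the invariant classes of the complementary degree `2q = 2d − 2p` are algebraic on `X_t`". THIS FILE shows that on a compact
pencil of abelian varieties (B) FOLLOWS FROM (A):
* `2p ≤ d` (§2): the hard Lefschetz isomorphism `L_κ^{q−p} : H^{2p}(X_t) → H^{2q}(X_t)` of the restriction `κ = j_t^* K` of a global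
  algebraic polarisation `K` (part XXI-a `exists_algebraic_globalPolarization`) maps the invariants ONTO the invariants (injective, and
  `dim j_t^* H^{2p} = dim j_t^* H^{2q}`, part XXVI-a), and `L_κ^{q−p} j_t^* x = j_t^*(L_K^{q−p} x)` is algebraic on `X_t` for `x ∈ Nᵖ(𝒳)`
  (Fulton's pull-back theorem `fulton1998_map_mem_algebraicClasses_holds`, a tree theorem, and `L_K` preserves algebraic classes);
* `2p > d` (§3): every invariant class of degree `2p` is algebraic on `X_t` by (A) and pull-back; an invariant `w` of degree `2q < d` has
  `L_κ^{p−q} w` invariant of degree `2p`, hence algebraic, and Grothendieck's `A(X_t, κ)` — a THEOREM for abelian fibres (Lieberman, part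
  XXII-c/d `standardConjectureA_fiberOver`) — gives an algebraic `w'` with `L^{p−q} w' = L^{p−q} w`, so `w = w'` (hard Lefschetz).

## What is proved (theorems only; no definition, no named fact, no sorry)

§1 bookkeeping: `sup_ker_eq_top_iff_range_le_map` ((A) ⟺ `Nᵖ(𝒳) ⊔ ker j_t^* = ⊤`), `range_le_algebraicClasses_of_range_le_map` ((A) ⟹
the invariants of degree `2p` are algebraic on `X_t`, Fulton), two `subst` transports.
§2 `map_range_lefschetzPowTo_eq_range` (general family: `L_κʳ(j_t^* H^{2p}) = j_t^* H^{2q}` for `2p + r = n`, `p + r = q`),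
`range_le_algebraicClasses_compl_of_le` ((A) ⟹ (B) for `2p ≤ d` on a pencil).
§3 `range_le_algebraicClasses_compl_of_lt` ((A) ⟹ (B) for `2p > d`, via `A(X_t)`).
§4 HEADLINES (compact abelian pencil, `t` any point, `p + q = d`, NO further hypothesis):
**`range_le_map_iff_exists_lerayIdempotentC'`** — (A) ⟺ [∃ `e` with (Π1), (π), (κ) and `Im e ⊆ Nᵖ(𝒳)`];
**`sup_ker_eq_top_iff_exists_lerayIdempotentC`** — `Nᵖ(𝒳) ⊔ ker j_t^* = ⊤` ⟺ the same;
**`comap_le_sup_iff_exists_lerayIdempotentC'`** — at a point where the invariant classes of degree `2p` (ONLY) are algebraic on the fibre,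
(L)_t(p) ⟺ the same (part XXVIII-a's headline without its clause in degree `2q`).
§5 bracket level (display-only): `CMIdempotentPackage[inv,deg]` (the package at the CM points and degrees where the invariants are algebraic)
⟸ (L) (K), ⟸ `HC_AV` mod Verdier (on-path through abelian varieties), and `CMIdempotentPackage[inv,deg] ⟹ CMIdempotentPackage[inv]`
(part XXVIII-b's bracket, which asked the clause in every degree).

## Honest status

No node is born; nothing is minimal; nothing here is fact-free progress on `HC_AV`. Net effect on the record: the find-the-cycles form of
the André-axis candidate at `(t, p)` — "an algebraic `(d+1)`-cycle on `𝒳 × 𝒳` acting on `H^{2p}(𝒳)` as a Leray idempotent whose image is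
spanned by algebraic `p`-cycles" — is EQUIVALENT, with no side condition at all, to "`Nᵖ(𝒳)` maps onto the fixed part `j_t^* H^{2p}(𝒳)`",
a property of (pencil, degree) (part XXVIII-a §4: `ker j_t^*` does not depend on `t`). It is NOT on-path in general (a pencil with a
constant CM factor has non-Hodge invariants) — exactly as the habitat discussion of part XXVIII-b says; under the degree-`2p` clause it is
(L)_t(p), on-path modulo Verdier.

References: Milne2020HodgeClassesAV (proof of Prop. 1, pp. 7–8); DeningerMurre1991 (Thm. 3.1); Kleiman1968AlgebraicCycles (§2, 2A11, §3);
Lieberman1968; Grothendieck1968 (§3); Fulton1998 (Cor. 19.2 (b)); VoisinHodgeI2002 (Thm. 6.25); DeligneHodgeII1971 (Thm. 4.1.1).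
-/

noncomputable section

set_option linter.dupNamespace false

namespace Summit.HodgeConjecture.HodgeConjecture.Ring2.AbelianAll

open CategoryTheory AlgebraicGeometry
open Literature.AlgebraicGeometry Literature.AlgebraicGeometry.Motives
open Literature.AlgebraicGeometry.HodgeTheory
open Literature.AlgebraicGeometry.Deligne1982 (cmLocus)
open Literature.Geometry.Kaehler (lefschetzPow HasHardLefschetzProperty)
open Summit.HodgeConjecture.HodgeConjecture
open Summit.HodgeConjecture.HodgeConjecture.Theses
open Summit.HodgeConjecture.HodgeConjecture.Theorems (fulton1998_map_mem_algebraicClasses_holds)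

/-! ## §1 Bookkeeping -/

section Bookkeeping

variable {𝒳 S : SchemeOver ℂ} {f : 𝒳 ⟶ S}

/-- **(A) ⟺ `Nᵖ(𝒳) ⊔ ker j_t^* = H^{2p}(𝒳)`**: every invariant class of degree `2p` is the restriction of an algebraic class iff every
class of `𝒳` is algebraic modulo the classes dying on `X_t`. [cite: Milne2020HodgeClassesAV, proof of Prop. 1 (p. 7)] -/
theorem sup_ker_eq_top_iff_range_le_map (t : ComplexPoints S) {p : ℕ} :
    algebraicClasses 𝒳 p ⊔ LinearMap.ker (complexBetti.map (fiberι f t) (2 * p)).hom = ⊤ ↔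
      LinearMap.range (complexBetti.map (fiberι f t) (2 * p)).hom ≤
        (algebraicClasses 𝒳 p).map (complexBetti.map (fiberι f t) (2 * p)).hom := by
  constructor
  · intro h
    rintro _ ⟨u, rfl⟩
    obtain ⟨y, hy, z, hz, hyz⟩ := Submodule.mem_sup.1 (h ▸ Submodule.mem_top (x := u))
    refine Submodule.mem_map.2 ⟨y, hy, ?_⟩
    rw [LinearMap.mem_ker] at hz
    rw [← hyz, map_add, hz, add_zero]
  · intro h
    refine eq_top_iff.2 fun u _ ↦ ?_
    obtain ⟨y, hy, hyu⟩ := Submodule.mem_map.1 (h (LinearMap.mem_range_self _ u))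
    rw [show u = y + (u - y) by abel]
    refine Submodule.add_mem_sup hy ?_
    rw [LinearMap.mem_ker, map_sub, sub_eq_zero]
    exact hyu.symm

/-- **(A) ⟹ the invariant classes of degree `2p` are algebraic ON THE FIBRE** (Fulton's pull-back theorem Cor. 19.2 (b), the tree's
`fulton1998_map_mem_algebraicClasses_holds`). [cite: Fulton1998, §19.2 Cor. 19.2 (b)] [cite: VoisinHodgeII2003, §9.2.4 Prop. 9.21 (i)] -/
theorem range_le_algebraicClasses_of_range_le_map {n N : ℕ} (h𝒳 : IsSmoothProjective N 𝒳) (t : ComplexPoints S)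
    (hXt : IsSmoothProjective n (fiberOver f t)) {p : ℕ}
    (hA : LinearMap.range (complexBetti.map (fiberι f t) (2 * p)).hom ≤
      (algebraicClasses 𝒳 p).map (complexBetti.map (fiberι f t) (2 * p)).hom) :
    LinearMap.range (complexBetti.map (fiberι f t) (2 * p)).hom ≤ algebraicClasses (fiberOver f t) p := by
  intro w hw
  obtain ⟨x, hx, rfl⟩ := Submodule.mem_map.1 (hA hw)
  exact fulton1998_map_mem_algebraicClasses_holds (fiberι f t) h𝒳 hXt p x hx

/-- Degree transport for `lefschetzPowTo` and the support filtration (`subst`). [folklore] -/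
theorem lefschetzPowTo_mem_supportedClasses_iff {X : SchemeOver ℂ} (κ : complexBetti X 2) (r k m : ℕ) (hm : k + 2 * r = m)
    (s : ℕ) (c : complexBetti X k) :
    lefschetzPowTo κ r k m hm c ∈ supportedClasses X m s ↔ lefschetzPow κ r k c ∈ supportedClasses X (k + 2 * r) s := by
  subst hm
  rfl

end Bookkeeping

/-! ## §2 Below the middle: hard Lefschetz maps the invariants of degree `2p` onto those of degree `2q`, so (A) ⟹ (B) -/

section Below

variable {n m N : ℕ} {𝒳 S : SchemeOver ℂ} {f : 𝒳 ⟶ S}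

/-- **`L_κʳ (j_t^* H^{2p}(𝒳)) = j_t^* H^{2q}(𝒳)`** for a smooth projective family, a global class `K ∈ H²(𝒳)` whose restriction
`κ = j_t^* K` has the hard Lefschetz property on `X_t` (dimension `n`), and `2p + r = n`, `p + r = q`: `L_κʳ j_t^* = j_t^* L_Kʳ` maps
invariants to invariants injectively (hard Lefschetz), and the two invariant spaces have the same dimension (part XXVI-a).
[cite: VoisinHodgeI2002, §6.2.3 Thm. 6.25] [cite: DeligneHodgeII1971, Thm. 4.1.1] -/
theorem map_range_lefschetzPowTo_eq_range (hS : IsSmoothProjective m S) (hf : IsSmoothProjectiveFamily f n)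
    (h𝒳 : IsSmoothProjective N 𝒳) (t : ComplexPoints S) (K : complexBetti 𝒳 2)
    (hK : HasHardLefschetzProperty (complexBetti.map (fiberι f t) 2 K) n) {p q r : ℕ} (hpr : 2 * p + r = n) (hpq : p + r = q) :
    (LinearMap.range (complexBetti.map (fiberι f t) (2 * p)).hom).map
        (lefschetzPowTo (complexBetti.map (fiberι f t) 2 K) r (2 * p) (2 * q) (by omega)) =
      LinearMap.range (complexBetti.map (fiberι f t) (2 * q)).hom := by
  have hY := hf.isSmoothProjective t
  haveI : Module.Finite ℂ (complexBetti (fiberOver f t) (2 * q)) := finite_complexBetti hY _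
  set L := lefschetzPowTo (complexBetti.map (fiberι f t) 2 K) r (2 * p) (2 * q) (by omega) with hL
  have hle : (LinearMap.range (complexBetti.map (fiberι f t) (2 * p)).hom).map L ≤
      LinearMap.range (complexBetti.map (fiberι f t) (2 * q)).hom := by
    rintro _ ⟨_, ⟨x, rfl⟩, rfl⟩
    refine ⟨lefschetzPowTo K r (2 * p) (2 * q) (by omega) x, ?_⟩
    change complexBetti.map (fiberι f t) (2 * q) (lefschetzPowTo K r (2 * p) (2 * q) _ x) = L (complexBetti.map (fiberι f t) (2 * p) x)
    rw [hL, map_fiberι_lefschetzPowTo t K r (2 * p) (2 * q) _ x]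
  have hinj : Function.Injective L := (bijective_lefschetzPowTo_of_hasHardLefschetz _ hK hpr (2 * q) (by omega)).1
  refine Submodule.eq_of_le_of_finrank_eq hle ?_
  rw [← (Submodule.equivMapOfInjective L hinj _).finrank_eq]
  exact finrank_range_map_fiberι_eq_of_add hS hf h𝒳 (show 2 * p + 2 * q = 2 * n by omega) t

/-- **Below the middle, (A) ⟹ (B)**: on a smooth projective family with a global ALGEBRAIC class `K ∈ N¹(𝒳)` restricting to a
hard-Lefschetz class on `X_t`, if every invariant class of degree `2p` (`2p ≤ n`) is the restriction of an algebraic class, then every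
invariant class of the complementary degree `2q = 2n − 2p` is algebraic on `X_t`: it is `L_κ^{q−p} j_t^* x = j_t^*(L_K^{q−p} x)` with
`x ∈ Nᵖ(𝒳)`, and pull-back (Fulton) and `L_κ` preserve algebraic classes. [cite: VoisinHodgeI2002, §6.2.3 Thm. 6.25]
[cite: Fulton1998, §19.2 Cor. 19.2 (b)] [cite: VoisinHodgeII2003, §9.2.4 Prop. 9.20] -/
theorem range_le_algebraicClasses_compl_of_le (hS : IsSmoothProjective m S) (hf : IsSmoothProjectiveFamily f n)
    (h𝒳 : IsSmoothProjective N 𝒳) (t : ComplexPoints S) {K : complexBetti 𝒳 2}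
    (hKt : IsPolarizationClass n (fiberOver f t) (complexBetti.map (fiberι f t) 2 K)) {p q r : ℕ} (hpr : 2 * p + r = n)
    (hpq : p + r = q)
    (hA : LinearMap.range (complexBetti.map (fiberι f t) (2 * p)).hom ≤
      (algebraicClasses 𝒳 p).map (complexBetti.map (fiberι f t) (2 * p)).hom) :
    LinearMap.range (complexBetti.map (fiberι f t) (2 * q)).hom ≤ algebraicClasses (fiberOver f t) q := by
  have hY := hf.isSmoothProjective t
  have hIp := range_le_algebraicClasses_of_range_le_map h𝒳 t hY hA
  rw [← map_range_lefschetzPowTo_eq_range hS hf h𝒳 t K hKt.hasHardLefschetz hpr hpq]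
  rintro _ ⟨a, ha, rfl⟩
  exact lefschetzPowTo_mem_algebraicClasses hY hKt.mem_algebraicClasses (hIp ha) r q hpq (by omega)

end Below

/-! ## §3 Above the middle: `A(X_t, κ)` (Lieberman) turns algebraicity of the invariants of degree `2p` into that of degree `2q` -/

section Above

variable {𝒳 S : SchemeOver ℂ} {d : ℕ} {f : 𝒳 ⟶ S}

/-- **Above the middle, (A) ⟹ (B) on a compact abelian pencil**: if `2p > d`, `p + q = d`, `κ = j_t^* K` a polarisation class of the fibre,
and every invariant class of degree `2p` is the restriction of an algebraic class, then every invariant class `w` of degree `2q` is algebraic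
on `X_t`: `L_κ^{p−q} w` is invariant of degree `2p`, hence algebraic (Fulton); `A(X_t, κ)` (Lieberman — a tree theorem for abelian fibres,
`standardConjectureA_fiberOver`) gives an algebraic `w'` of degree `2q` with `L^{p−q} w' = L^{p−q} w`, and `L^{p−q}` is injective on `H^{2q}`
(hard Lefschetz). [cite: Lieberman1968, main theorem] [cite: Kleiman1968AlgebraicCycles, Appendix to §2, Thm. 2A11 and §3]
[cite: Grothendieck1968, §3 p. 196] -/
theorem range_le_algebraicClasses_compl_of_lt (hf : IsCompactAbelianPencil f d) (t : ComplexPoints S) {K : complexBetti 𝒳 2}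
    (hKt : IsPolarizationClass d (fiberOver f t) (complexBetti.map (fiberι f t) 2 K)) {p q r : ℕ} (hqr : 2 * q + r = d)
    (hpq : q + r = p)
    (hA : LinearMap.range (complexBetti.map (fiberι f t) (2 * p)).hom ≤
      (algebraicClasses 𝒳 p).map (complexBetti.map (fiberι f t) (2 * p)).hom) :
    LinearMap.range (complexBetti.map (fiberι f t) (2 * q)).hom ≤ algebraicClasses (fiberOver f t) q := by
  have h𝒳 := hf.isSmoothProjective_total
  have hY := hf.isSmoothProjective_fiberOver t
  have hIp := range_le_algebraicClasses_of_range_le_map h𝒳 t hY hA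
  set κ := complexBetti.map (fiberι f t) 2 K with hκ
  have hAconj := standardConjectureA_fiberOver hf t hKt
  rintro _ ⟨x, rfl⟩
  -- `L^r (j_t^* x) = j_t^* (L_K^r x)` is an invariant class of degree `2p`, hence algebraic on the fibre
  have hmem : lefschetzPowTo κ r (2 * q) (2 * p) (by omega) (complexBetti.map (fiberι f t) (2 * q) x) ∈
      algebraicClasses (fiberOver f t) p := by
    refine hIp ⟨lefschetzPowTo K r (2 * q) (2 * p) (by omega) x, ?_⟩
    change complexBetti.map (fiberι f t) (2 * p) (lefschetzPowTo K r (2 * q) (2 * p) _ x) = _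
    rw [hκ, map_fiberι_lefschetzPowTo t K r (2 * q) (2 * p) _ x]
  -- in the spelling of `A(X_t, κ)`
  have hmem' : lefschetzPow κ r (2 * q) (complexBetti.map (fiberι f t) (2 * q) x) ∈
      supportedClasses (fiberOver f t) (2 * q + 2 * r) p :=
    (lefschetzPowTo_mem_supportedClasses_iff κ r (2 * q) (2 * p) (by omega) p _).1 hmem
  obtain ⟨w', hw', heq⟩ := (hAconj.2 q r p hqr hpq).surjOn hmem'
  have hinj : Function.Injective (lefschetzPow κ r (2 * q)) := (hAconj.1 r (2 * q) hqr).1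
  rw [← hinj heq]
  exact hw'

end Above

/-! ## §4 Headlines: no hypothesis on the complementary degree -/

section Headlines

variable {𝒳 S : SchemeOver ℂ} {d : ℕ} {f : 𝒳 ⟶ S}

/-- **(A) ⟹ (B) in every degree on a compact abelian pencil** (`p + q = d`; §2 below the middle with the global algebraic polarisation of
part XXI-a, §3 above it). [cite: VoisinHodgeI2002, Thm. 6.25] [cite: Lieberman1968, main theorem] [cite: Fulton1998, Cor. 19.2 (b)] -/
theorem range_le_algebraicClasses_compl (hf : IsCompactAbelianPencil f d) (t : ComplexPoints S) {p q : ℕ} (hpq : p + q = d)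
    (hA : LinearMap.range (complexBetti.map (fiberι f t) (2 * p)).hom ≤
      (algebraicClasses 𝒳 p).map (complexBetti.map (fiberι f t) (2 * p)).hom) :
    LinearMap.range (complexBetti.map (fiberι f t) (2 * q)).hom ≤ algebraicClasses (fiberOver f t) q := by
  obtain ⟨K, -, -, hKs⟩ := exists_algebraic_globalPolarization hf
  rcases le_or_gt p q with h | h
  · exact range_le_algebraicClasses_compl_of_le hf.isSmoothProjective_base hf.isSmoothProjectiveFamily hf.isSmoothProjective_total t
      (hKs t) (r := q - p) (by omega) (by omega) hA
  · exact range_le_algebraicClasses_compl_of_lt hf t (hKs t) (r := p - q) (by omega) (by omega) hA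

/-- **HEADLINE — (A) ⟺ [∃ algebraic Leray idempotent at `(t, 2p)` with algebraic image], for every `p + q = d`, NO further hypothesis.**
On a compact pencil of abelian `d`-folds and any point `t`: every invariant class of degree `2p` of `X_t` is the restriction of an algebraic
class of `𝒳` IFF there is an endomorphism `e` of `H^{2p}(𝒳(ℂ); ℂ)` induced by an algebraic cycle on `𝒳 × 𝒳` with `j_t^* e = j_t^*`,
`e|ker j_t^* = 0` and `Im e ⊆ Nᵖ(𝒳)` (part XXVIII-a's construction, its hypothesis (B) supplied by `range_le_algebraicClasses_compl`).
[cite: Milne2020HodgeClassesAV, proof of Prop. 1 (pp. 7–8)] [cite: DeningerMurre1991, Thm. 3.1 and Cor. 3.2] [cite: Lieberman1968, main theorem] -/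
theorem range_le_map_iff_exists_lerayIdempotentC' (hf : IsCompactAbelianPencil f d) (t : ComplexPoints S) {p q : ℕ}
    (hpq : p + q = d) :
    LinearMap.range (complexBetti.map (fiberι f t) (2 * p)).hom ≤
        (algebraicClasses 𝒳 p).map (complexBetti.map (fiberι f t) (2 * p)).hom ↔
      ∃ e : complexBetti 𝒳 (2 * p) →ₗ[ℂ] complexBetti 𝒳 (2 * p),
        IsAlgebraicCorrespondence (d + 1) (d + 1) 𝒳 𝒳 e ∧
        (∀ w, complexBetti.map (fiberι f t) (2 * p) (e w) = complexBetti.map (fiberι f t) (2 * p) w) ∧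
        (∀ w, complexBetti.map (fiberι f t) (2 * p) w = 0 → e w = 0) ∧
        (∀ w, e w ∈ algebraicClasses 𝒳 p) :=
  ⟨fun hA ↦ exists_lerayIdempotentC_of_range_le_map hf t hpq hA (range_le_algebraicClasses_compl hf t hpq hA),
    fun ⟨e, _, hπ, _, halg⟩ ↦ range_le_map_of_exists_lerayIdempotent t ⟨e, hπ, halg⟩⟩

/-- **HEADLINE — `Nᵖ(𝒳) + ker j_t^* = H^{2p}(𝒳)` ⟺ [∃ algebraic Leray idempotent at `(t, 2p)` with algebraic image]** (`p + q = d`):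
the find-the-cycles form of the André-axis candidate at `(t, p)` is the statement that the algebraic classes of the total space map ONTO the
fixed part `j_t^* H^{2p}(𝒳)` — a property of (pencil, degree), `ker j_t^*` being independent of `t` (part XXVIII-a §4).
[cite: Milne2020HodgeClassesAV, proof of Prop. 1 (pp. 7–8)] [cite: DeningerMurre1991, Thm. 3.1 and Cor. 3.2] -/
theorem sup_ker_eq_top_iff_exists_lerayIdempotentC (hf : IsCompactAbelianPencil f d) (t : ComplexPoints S) {p q : ℕ}
    (hpq : p + q = d) :
    algebraicClasses 𝒳 p ⊔ LinearMap.ker (complexBetti.map (fiberι f t) (2 * p)).hom = ⊤ ↔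
      ∃ e : complexBetti 𝒳 (2 * p) →ₗ[ℂ] complexBetti 𝒳 (2 * p),
        IsAlgebraicCorrespondence (d + 1) (d + 1) 𝒳 𝒳 e ∧
        (∀ w, complexBetti.map (fiberι f t) (2 * p) (e w) = complexBetti.map (fiberι f t) (2 * p) w) ∧
        (∀ w, complexBetti.map (fiberι f t) (2 * p) w = 0 → e w = 0) ∧
        (∀ w, e w ∈ algebraicClasses 𝒳 p) :=
  (sup_ker_eq_top_iff_range_le_map t).trans (range_le_map_iff_exists_lerayIdempotentC' hf t hpq)

/-- **HEADLINE — (L)_t(p) ⟺ [∃ algebraic Leray idempotent at `(t, 2p)` with algebraic image], at a point where the invariant classes OF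
DEGREE `2p` are algebraic on the fibre** (`p + q = d`; part XXVIII-a's `comap_le_sup_iff_exists_lerayIdempotentC` WITHOUT its clause in the
complementary degree `2q`). [cite: Milne2020HodgeClassesAV, proof of Prop. 1 (pp. 7–8)] [cite: Andre1996Motifs, §5.1 (p. 25) and Remarque 2 (p. 33)]
[cite: Lieberman1968, main theorem] -/
theorem comap_le_sup_iff_exists_lerayIdempotentC' (hf : IsCompactAbelianPencil f d) (t : ComplexPoints S) {p q : ℕ}
    (hpq : p + q = d)
    (hIp : LinearMap.range (complexBetti.map (fiberι f t) (2 * p)).hom ≤ algebraicClasses (fiberOver f t) p) :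
    (algebraicClasses (fiberOver f t) p).comap (complexBetti.map (fiberι f t) (2 * p)).hom ≤
        algebraicClasses 𝒳 p ⊔ LinearMap.ker (complexBetti.map (fiberι f t) (2 * p)).hom ↔
      ∃ e : complexBetti 𝒳 (2 * p) →ₗ[ℂ] complexBetti 𝒳 (2 * p),
        IsAlgebraicCorrespondence (d + 1) (d + 1) 𝒳 𝒳 e ∧
        (∀ w, complexBetti.map (fiberι f t) (2 * p) (e w) = complexBetti.map (fiberι f t) (2 * p) w) ∧
        (∀ w, complexBetti.map (fiberι f t) (2 * p) w = 0 → e w = 0) ∧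
        (∀ w, e w ∈ algebraicClasses 𝒳 p) :=
  ⟨fun hL ↦ (range_le_map_iff_exists_lerayIdempotentC' hf t hpq).1 (range_le_map_of_comap_le_sup hf t hIp hL),
    fun ⟨e, _, hπ, _, halg⟩ ↦ comap_le_sup_of_range_le_map t (range_le_map_of_exists_lerayIdempotent t ⟨e, hπ, halg⟩)⟩

/-- **(L)_t(p) ∧ [invariants of degree `2p` algebraic on `X_t`] ⟺ (A)** (the two readings of "every invariant class lifts to an algebraic
class"; ⟸ uses Fulton's pull-back theorem). [cite: Milne2020HodgeClassesAV, Prop. 1 (p. 7)] [cite: Fulton1998, Cor. 19.2 (b)] -/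
theorem comap_le_sup_and_range_le_iff_range_le_map (hf : IsCompactAbelianPencil f d) (t : ComplexPoints S) {p : ℕ} :
    ((algebraicClasses (fiberOver f t) p).comap (complexBetti.map (fiberι f t) (2 * p)).hom ≤
          algebraicClasses 𝒳 p ⊔ LinearMap.ker (complexBetti.map (fiberι f t) (2 * p)).hom ∧
        LinearMap.range (complexBetti.map (fiberι f t) (2 * p)).hom ≤ algebraicClasses (fiberOver f t) p) ↔
      LinearMap.range (complexBetti.map (fiberι f t) (2 * p)).hom ≤
        (algebraicClasses 𝒳 p).map (complexBetti.map (fiberι f t) (2 * p)).hom :=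
  ⟨fun h ↦ range_le_map_of_comap_le_sup hf t h.2 h.1, fun hA ↦ ⟨comap_le_sup_of_range_le_map t hA,
    range_le_algebraicClasses_of_range_le_map hf.isSmoothProjective_total t (hf.isSmoothProjective_fiberOver t) hA⟩⟩

end Headlines

/-! ## §5 Bracket level (display-only): the clause degree by degree -/

section Nodes

variable {𝒳 S : SchemeOver ℂ} {d : ℕ} {f : 𝒳 ⟶ S}

/-- DISPLAY-ONLY bracket (no `def`; REFEREE-AB F-ab-103): `CMIdempotentPackage[inv]` of part XXVIII-b, restated verbatim (clause in EVERY degree). -/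
local notation3 (prettyPrint := false) "CMIdempotentPackage[inv]" =>
  ∀ ⦃d : ℕ⦄ ⦃𝒳 S : SchemeOver ℂ⦄ (f : 𝒳 ⟶ S), IsCompactAbelianPencil f d → ∀ t ∈ cmLocus f d,
    (∀ a : ℕ, LinearMap.range (complexBetti.map (fiberι f t) (2 * a)).hom ≤ algebraicClasses (fiberOver f t) a) →
    ∀ p : ℕ, p ≤ d →
    ∃ e : complexBetti 𝒳 (2 * p) →ₗ[ℂ] complexBetti 𝒳 (2 * p),
      IsAlgebraicCorrespondence (d + 1) (d + 1) 𝒳 𝒳 e ∧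
      (∀ w, complexBetti.map (fiberι f t) (2 * p) (e w) = complexBetti.map (fiberι f t) (2 * p) w) ∧
      (∀ w, complexBetti.map (fiberι f t) (2 * p) w = 0 → e w = 0) ∧
      (∀ w, e w ∈ algebraicClasses 𝒳 p)

/-- DISPLAY-ONLY bracket (no `def`; F-ab-103): **`CMIdempotentPackage[inv,deg]`** — at every CM point `t` and every degree `2p ≤ 2d` AT WHICH
the invariant classes of `X_t` are algebraic, an algebraic Leray idempotent with algebraic image. The clause is asked in the degree at hand
only (this part), not in every degree (part XXVIII-b). A HYPOTHESIS wherever used; implied by (L). -/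
local notation3 (prettyPrint := false) "CMIdempotentPackage[inv,deg]" =>
  ∀ ⦃d : ℕ⦄ ⦃𝒳 S : SchemeOver ℂ⦄ (f : 𝒳 ⟶ S), IsCompactAbelianPencil f d → ∀ t ∈ cmLocus f d, ∀ p : ℕ, p ≤ d →
    LinearMap.range (complexBetti.map (fiberι f t) (2 * p)).hom ≤ algebraicClasses (fiberOver f t) p →
    ∃ e : complexBetti 𝒳 (2 * p) →ₗ[ℂ] complexBetti 𝒳 (2 * p),
      IsAlgebraicCorrespondence (d + 1) (d + 1) 𝒳 𝒳 e ∧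
      (∀ w, complexBetti.map (fiberι f t) (2 * p) (e w) = complexBetti.map (fiberι f t) (2 * p) w) ∧
      (∀ w, complexBetti.map (fiberι f t) (2 * p) w = 0 → e w = 0) ∧
      (∀ w, e w ∈ algebraicClasses 𝒳 p)

/-- `CMIdempotentPackage[inv,deg] ⟹ CMIdempotentPackage[inv]` (the degree-wise clause is weaker than the every-degree clause). [folklore] -/
theorem cmIdempotentPackageInv_of_cmIdempotentPackageInvDeg (h : CMIdempotentPackage[inv,deg]) : CMIdempotentPackage[inv] :=
  fun _ _ _ f hf t ht hI p hp ↦ h f hf t ht p hp (hI p)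

/-- **(L) ⟹ `CMIdempotentPackage[inv,deg]`** (K, fact-free): at a CM point, in a degree where the invariants are algebraic on the fibre, the
lift gives the idempotent with algebraic image (§4, no clause in the complementary degree). [cite: Milne2020HodgeClassesAV, proof of Prop. 1 (pp. 7–8)]
[cite: Lieberman1968, main theorem] -/
theorem cmIdempotentPackageInvDeg_of_cmFibreAlgebraicLift (hL : CMFibreAlgebraicLift) : CMIdempotentPackage[inv,deg] :=
  fun d _ _ f hf t ht p hp hIp ↦ (comap_le_sup_iff_exists_lerayIdempotentC' hf t (show p + (d - p) = d by omega) hIp).1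
    (cmFibreAlgebraicLift_iff_comap_le_sup.1 hL f hf p t ht)

/-- **ON-PATH THROUGH ABELIAN VARIETIES: `HC_AV ⟹ CMIdempotentPackage[inv,deg]`, granted Verdier 1976** (part XX: `HC_AV ⟹ (L)`).
[cite: Verdier1976, Cor. 5.1] [cite: Andre1996Motifs, §6.3 (p. 33)] -/
theorem cmIdempotentPackageInvDeg_of_HC_AV_of_verdier (hGT : Verdier1976_genericLocalTriviality)
    (h : PadicSemiregularLift.HodgeAbelianVarieties) : CMIdempotentPackage[inv,deg] :=
  cmIdempotentPackageInvDeg_of_cmFibreAlgebraicLift (cmFibreAlgebraicLift_of_HC_AV_of_verdier hGT h)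

end Nodes

end Summit.HodgeConjecture.HodgeConjecture.Ring2.AbelianAll

end
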